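import Summits.QuantumFields.YangMills.Theses.LocalInsertion
import Summits.QuantumFields.YangMills.Theorems.LocalInsertionHistoryTailOfInsertionLPerPlaquette
import Summits.QuantumFields.YangMills.Theorems.StretchedTailHistoryTailOfOrlicz
import HarnessLib

/-!
# Route `LocalInsertion` (planner ym-r3-idea-2 g7, LINE 16 «LocalInsertion», lens «nearmiss»), glue item `HistoryTailOfInsertionL`
# (stmt-QuantumFields-23608), PROVED: `LocalInsertionL → UnitScaleTilt.HistoryTailL`

Given thresholds `(b₁, p₁)` for the line `L`: take the local-insertion rate `ε = ε(L) > 0`, the profile `b₀ = max(b₁, 6, 8/ε)` (so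
`ε b₀ ≥ 8`, `b₀² ≥ 32`), `p₀ = max(p₁, 3)`, then the local-insertion constants `M₀ ≥ 0`, `γ₁ ∈ (0,1]`.  For `F.L = L`, `0 < γ ≤ γ₁` the
per-plaquette log-square tails of `HistoryTailOfInsertion.perPlaquette_of_localInsertion` (Chernoff on the local good sets + finest bad level +
the bare per-plaquette bound; width seat w3's local counting) feed the tree's log-square union bound `StretchedTailHistoryTailOfOrlicz.averagedTailAt_of_perPlaquette_logSq` and
`T3BareTailProfile.historyTailAt_of_averagedTailAt` (bare height by the landed `bareTailAt`) for every free top fraction `m ≥ 1`.  This is the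
critic's «glue arithmetic» of VERDICT #188: a LINEAR-exponential tail with any fixed `ε` suffices once `b₀ ≥ 8/ε` because the `p`-function
increments `p(g_{K−i}) − p(g_{K−j}) ≥ b₀(j−i)·log L/2` beat the local volumes.  (A packaging door in geometric currency,
`LocalInsertionLinExpDoor.historyTailL_of_linExpTail` of cell ym3-torus, landed independently; it is not used here because the bare level is
absorbed in log-square rather than linear-exponential currency.)

HONEST FRAMING: the crux `LocalInsertionL` (stmt-QuantumFields-23607, XL; instrument row R16 and the literature row of #188 come first) and the
route's residual cruxes 20520 / 19200 are OPEN; glue only; no rung (R3 = `YM3TorusSU2` is a RECORD rung), no summit, no continuum limit and no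
Yang–Mills mass gap is proved by any of this.  Cell `ym-idea-1`, width seat `ym-line-sfw-p2-w5` g12 (R3 family; free hands).  THEOREMS ONLY.
References: T. Bałaban, CMP 102 (1985) 255–275, (7), (71) [Balaban1985UV3].
-/

set_option autoImplicit false

noncomputable section

open scoped BigOperators
open MeasureTheory Filter Topology
open Literature.MathematicalPhysics.QuantumFieldTheory.Balaban1983to89
open Literature.MathematicalPhysics.QuantumFieldTheory.Balaban1983to89.T3ContinuumYM3Torus
open Literature.MathematicalPhysics.QuantumFieldTheory.Balaban1983to89.T3UnitScaleTilt
open Literature.MathematicalPhysics.QuantumFieldTheory.Balaban1983to89.T3UnitLawDensityEML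
open Literature.MathematicalPhysics.QuantumFieldTheory.Balaban1983to89.T3BareTailProfile

namespace Summit.QuantumFields.YangMills.Theorems.LocalInsertion.HistoryTailOfInsertion

/-! ## §5 The glue `HistoryTailOfInsertionL` -/

/-- **Support item `HistoryTailOfInsertionL` (stmt-QuantumFields-23608) of route `LocalInsertion` holds**: `LocalInsertionL → HistoryTailL`.
Given thresholds `(b₁, p₁)` take the local-insertion rate `ε = ε(L)`, the profile `b₀ = max(b₁, 6, 8/ε)`, `p₀ = max(p₁, 3)`, the
local-insertion constants `M₀, γ₁`; for `γ ≤ γ₁ (≤ 1)` the per-plaquette log-square tails of `perPlaquette_of_localInsertion` feed the union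
bound `averagedTailAt_of_logSq` and the tree's `historyTailAt_of_averagedTailAt` (bare height by the tree's `bareTailAt`) for every free top
fraction `m ≥ 1`.  HONEST FRAMING: the crux `LocalInsertionL` (stmt-QuantumFields-23607) and the route's residuals 20520/19200 are OPEN; this is
glue only; no rung (R3 RECORD), no summit, no continuum limit and no mass gap is proved. [cite: Balaban1985UV3, (7) p.257 and (71) p.273] -/
theorem historyTailOfInsertionL_proof : Summit.QuantumFields.YangMills.Theses.LocalInsertion.HistoryTailOfInsertionL := by
  intro hLI L b₁ p₁
  obtain ⟨ε, hε, hLIε⟩ := hLI L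
  -- the profile
  set b₀ : ℝ := max b₁ (max 6 (8 / ε)) with hb₀def
  set p₀ : ℝ := max p₁ 3 with hp₀def
  have hb₀6 : 6 ≤ b₀ := (le_max_left _ _).trans (le_max_right _ _)
  have hb₀pos : 0 < b₀ := by linarith
  have hb₀ε : 8 / ε ≤ b₀ := (le_max_right _ _).trans (le_max_right _ _)
  have hεb : 8 ≤ ε * b₀ := by
    have := mul_le_mul_of_nonneg_left hb₀ε hε.le
    rwa [mul_div_cancel₀ _ hε.ne'] at this
  have hb32 : 32 ≤ b₀ ^ 2 := by nlinarith
  have hp₀3 : 3 ≤ p₀ := le_max_right _ _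
  have hp₀2 : 2 < p₀ := by linarith
  obtain ⟨M₀, hM₀, γ₁, hγ₁, hγ₁1, hrunAll⟩ := hLIε b₀ p₀ hb₀pos hp₀2
  refine ⟨b₀, p₀, le_max_left _ _, le_max_left _ _, hb₀pos, hp₀2, fun m hm => ⟨γ₁, hγ₁, fun F γ hFL hγ hγle => ?_⟩⟩
  have hγ1 : γ ≤ 1 := hγle.trans hγ₁1
  have hrun := hrunAll F γ hFL hγ hγle
  -- the per-plaquette tails, the union bound, the history tail
  obtain ⟨C, hC, hper⟩ := perPlaquette_of_localInsertion F hγ hγ1 hε hM₀ hb₀pos hεb hb32 hp₀2.le hrun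
  have hAv : AveragedTailAt F γ b₀ p₀ :=
    Summit.QuantumFields.YangMills.Theorems.StretchedTailHistoryTailOfOrlicz.averagedTailAt_of_perPlaquette_logSq F hγ hγ1
      ⟨C, 5, 8, hC, by norm_num, hper⟩
  exact historyTailAt_of_averagedTailAt F hγ hγ1 hb₀pos (by linarith) hm hAv


end Summit.QuantumFields.YangMills.Theorems.LocalInsertion.HistoryTailOfInsertion

end
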